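import Literature.NumberTheory.LFunctions.DedekindZetaNonvanishing
import Literature.NumberTheory.LFunctions.PrimeSumsHigherDegreeHalfPlane
import Literature.NumberTheory.Automorphic.GLOneStandardLTate
import Literature.Analysis.Complex.HolomorphicProducts
import HarnessLib

/-!
# FLOOR-0 P2, ROAD-W organ «W4-POLE» (A): the partial Dedekind zeta function away from a THIN set of places —
# factorisation, continuation to `re s > σ₀`, the simple pole at `s = 1`, non-vanishing on `re s ≥ 1`

(ORGAN W4-POLE (A) of ROAD-W v1 239b1f58, step W4 POLE «`L^S(s, π × μ′⁻¹) = ζ_F^S(s − ½) ζ_F^S(s + ½) L^S(s, ημ′⁻¹)` has a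
SIMPLE POLE at `s₀ = 3/2`; the places of degree `≥ 2` are thin and may stay unknown»; F0P2-p01 (g20), 2026-09-02.)  THEOREMS
ONLY (no definition, no instance, no named fact, no `sorry`); every input is tree currency cited BY NAME: ★ `partialStandardL`
(so the partial Dedekind zeta function is WRITTEN `ζ_K^S(s) = partialStandardL S (fun _ => {1}) s = ∏'_{v ∉ S} (1 − q_v^{-s})⁻¹`,
`q_v = v.residueCard = N(v)`), Hecke's continuation ★ `dedekindZetaCont K` with its PROVED properties ★
`NumberField.isDedekindZetaContinuation_dedekindZetaCont_holds`, ★ `tendsto_sub_one_mul_dedekindZetaCont_holds` (residue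
`ρ_K = dedekindZeta_residue K > 0`), ★ `dedekindZetaCont_ne_zero_of_one_le_re_holds` (Landau), the Euler product ★
`hasProd_dedekindEulerFactor_holds`, and the thin Euler factor `E_S(s) = ∏'_{v ∈ S} (1 − q_v^{-s})` (written out).
HYPOTHESIS ON `S`: `Summable (fun v : S => (q_v : ℝ) ^ (-σ₀))` — finite `S` (any `σ₀`), or `S ⊆ S₀ ∪ {places of residue
degree ≥ 2}`, `S₀` finite (any `σ₀ > 1/2`, ★ `summable_absNorm_rpow_neg_subtype_not_prime` p850785), §5.
STATEMENTS: §2 `E_S` holomorphic on `{σ₀ < re s}`, non-zero for `re s > 0`; §3 on `re s > 1`: `HasProd` to `ζ_K^S(s) ≠ 0` (any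
`S`) and `ζ_K^S(s) = ζ_K(s) · E_S(s) = dedekindZetaCont K s · E_S(s)` (Mathlib `HasProd.mul_compl`), plus the singleton family
`L^S(s, c) = ∏'_{v ∉ S} (1 − c_v q_v^{-s})⁻¹`, `‖c_v‖ ≤ 1` (`HasProd`, holomorphic, non-zero on `re s > 1`); §4 (`σ₀ < 1`):
`s ↦ dedekindZetaCont K s · E_S(s)` is holomorphic on `{σ₀ < re s} ∖ {1}`, `(s − 1)·(it) → ρ_K · E_S(1) ≠ 0` on `𝓝[≠] 1`, the
function `(s − 1)·(it)` extended by `ρ_K · E_S(1)` is holomorphic on `{σ₀ < re s}` (removable singularity), and `(it) ≠ 0` for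
`1 ≤ re s`, `s ≠ 1` — i.e. **`ζ_K^S` continues meromorphically to `re s > σ₀` with exactly one pole, simple, at `s = 1`, residue
`ρ_K ∏_{v ∈ S}(1 − q_v⁻¹) ≠ 0`, and no zero on `re s ≥ 1`**.  File (B) `F0P2wThetaPartialLPole.lean` assembles W4 at `s − ½`,
`s + ½`, `s`.  Sources (reader's; kernel inputs are the ★ names): Neukirch *ANT* VII (5.2), Cor. (5.11), §13 proof of (13.2);
Lang *ANT* VIII §2 Thm. 5, XV; Jacquet–Shalika, Amer. J. Math. 103 (1981) §5 Thm. (5.3).  Parked under `Theorems/` (ruling (α)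
of PLAN-P2 v18 add. 1, as L1/L2): generic number theory, upstream candidate.
Cell hodgecm-mathlib (D-0151), FLOOR 0, crux item H413 = stmt-HodgeConjecture-24833; lane `--kind proof --supports
stmt-HodgeConjecture-24833 --as helper`; touches no registry and no served Line.  HONEST LABEL: HC_CM is proved only modulo
the printed citations until rung 0 closes; this file proves nothing about them. [folklore]
-/
set_option autoImplicit false
set_option linter.dupNamespace false -- the mandated namespace repeats `HodgeConjecture.HodgeConjecture`

noncomputable section

open Filter Topology Complex NumberField IsDedekindDomain
open Literature.NumberTheory.Automorphic Literature.NumberTheory.LFunctions Literature.Analysis.Complex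
open Literature.NumberTheory.LFunctions.AbelianDensity

namespace Summit.HodgeConjecture.HodgeConjecture.Cruxes.H413.F0P2wPartialDedekindZetaPole

variable {K : Type} [Field K] [NumberField K]

/-! ## §1 One place: `q_v^{-s}` and the factor `1 − c q_v^{-s}` (`(eulerPolynomial {c}).eval` by ★ `eval_eulerPolynomial_singleton`) -/

/-- `‖q_v^{-s}‖ = q_v^{-re s}`. [folklore] -/
theorem norm_residueCard_cpow_neg (v : HeightOneSpectrum (𝓞 K)) (s : ℂ) :
    ‖(v.residueCard : ℂ) ^ (-s)‖ = (v.residueCard : ℝ) ^ (-s.re) := by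
  rw [norm_natCast_cpow_of_pos (zero_lt_one.trans v.one_lt_residueCard), neg_re]

/-- `‖q_v^{-s}‖ ≤ q_v^{-σ₀}` on the closed half-plane `σ₀ ≤ re s` (`q_v > 1`). [folklore] -/
theorem norm_residueCard_cpow_neg_le (v : HeightOneSpectrum (𝓞 K)) {σ₀ : ℝ} {s : ℂ} (hs : σ₀ ≤ s.re) :
    ‖(v.residueCard : ℂ) ^ (-s)‖ ≤ (v.residueCard : ℝ) ^ (-σ₀) := by
  rw [norm_residueCard_cpow_neg]
  have hq1 : (1 : ℝ) ≤ v.residueCard := by exact_mod_cast v.one_lt_residueCard.le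
  exact Real.rpow_le_rpow_of_exponent_le hq1 (by linarith)

/-- `s ↦ q_v^{-s}` is entire. [folklore] -/
theorem differentiable_residueCard_cpow_neg (v : HeightOneSpectrum (𝓞 K)) :
    Differentiable ℂ fun s : ℂ => (v.residueCard : ℂ) ^ (-s) :=
  differentiable_id.neg.const_cpow
    (Or.inl (Nat.cast_ne_zero.mpr (zero_lt_one.trans v.one_lt_residueCard).ne'))

/-- The factor `1 − c q_v^{-s}` does not vanish when `‖c‖ ≤ 1` and `re s > 0` (`‖c q_v^{-s}‖ ≤ q_v^{-re s} < 1`). [folklore] -/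
theorem one_sub_mul_residueCard_cpow_neg_ne_zero (v : HeightOneSpectrum (𝓞 K)) {c : ℂ} (hc : ‖c‖ ≤ 1)
    {s : ℂ} (hs : 0 < s.re) : 1 - c * (v.residueCard : ℂ) ^ (-s) ≠ 0 := by
  intro h
  have h1 : c * (v.residueCard : ℂ) ^ (-s) = 1 := (sub_eq_zero.mp h).symm
  have hq1 : (1 : ℝ) < v.residueCard := by exact_mod_cast v.one_lt_residueCard
  have h2 : ‖c * (v.residueCard : ℂ) ^ (-s)‖ < 1 := by
    rw [norm_mul, norm_residueCard_cpow_neg]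
    calc ‖c‖ * (v.residueCard : ℝ) ^ (-s.re) ≤ 1 * (v.residueCard : ℝ) ^ (-s.re) := by
          gcongr
      _ < 1 := by rw [one_mul]; exact Real.rpow_lt_one_of_one_lt_of_neg hq1 (by linarith)
  rw [h1, norm_one] at h2
  exact lt_irrefl _ h2

/-! ## §2 The thin Euler factor `E_S(s) = ∏'_{v ∈ S} (1 − q_v^{-s})` -/

section Thin

variable {S : Set (HeightOneSpectrum (𝓞 K))} {σ₀ : ℝ}

/-- The majorant: `‖(1 − q_v^{-s}) − 1‖ ≤ q_v^{-σ₀}` on `σ₀ < re s`. [folklore] -/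
theorem norm_thinFactor_sub_one_le (v : S) {s : ℂ} (hs : σ₀ < s.re) :
    ‖(1 - ((v : HeightOneSpectrum (𝓞 K)).residueCard : ℂ) ^ (-s)) - 1‖ ≤
      ((v : HeightOneSpectrum (𝓞 K)).residueCard : ℝ) ^ (-σ₀) := by
  rw [sub_sub_cancel_left, norm_neg]
  exact norm_residueCard_cpow_neg_le _ hs.le

/-- **`E_S` is holomorphic on `re s > σ₀`** when `∑_{v ∈ S} q_v^{-σ₀} < ∞`
(★ `differentiableOn_tprod_of_norm_sub_one_le`). [folklore] -/
theorem differentiableOn_thinEulerFactor (hS : Summable fun v : S => ((v : HeightOneSpectrum (𝓞 K)).residueCard : ℝ) ^ (-σ₀)) :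
    DifferentiableOn ℂ (fun s : ℂ => ∏' v : S, (1 - ((v : HeightOneSpectrum (𝓞 K)).residueCard : ℂ) ^ (-s)))
      {s : ℂ | σ₀ < s.re} :=
  differentiableOn_tprod_of_norm_sub_one_le (isOpen_lt continuous_const continuous_re)
    (fun v => ((differentiable_const (1 : ℂ)).sub (differentiable_residueCard_cpow_neg v.1)).differentiableOn)
    hS (fun v _ hs => norm_thinFactor_sub_one_le v hs)

/-- `E_S` converges (as an unconditional product) at every `s` with `re s > σ₀`. [folklore] -/
theorem hasProd_thinEulerFactor (hS : Summable fun v : S => ((v : HeightOneSpectrum (𝓞 K)).residueCard : ℝ) ^ (-σ₀))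
    {s : ℂ} (hs : σ₀ < s.re) :
    HasProd (fun v : S => 1 - ((v : HeightOneSpectrum (𝓞 K)).residueCard : ℂ) ^ (-s))
      (∏' v : S, (1 - ((v : HeightOneSpectrum (𝓞 K)).residueCard : ℂ) ^ (-s))) :=
  (multipliable_of_norm_sub_one_le (U := {s : ℂ | σ₀ < s.re}) hS
    (fun v _ hs => norm_thinFactor_sub_one_le v hs) hs).hasProd

/-- **`E_S(s) ≠ 0`** for `re s > σ₀` and `re s > 0` (no factor vanishes; ★ `tprod_ne_zero_of_norm_sub_one_le`). [folklore] -/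
theorem thinEulerFactor_ne_zero (hS : Summable fun v : S => ((v : HeightOneSpectrum (𝓞 K)).residueCard : ℝ) ^ (-σ₀))
    {s : ℂ} (hs : σ₀ < s.re) (hs0 : 0 < s.re) :
    ∏' v : S, (1 - ((v : HeightOneSpectrum (𝓞 K)).residueCard : ℂ) ^ (-s)) ≠ 0 := by
  refine tprod_ne_zero_of_norm_sub_one_le (U := {s : ℂ | σ₀ < s.re ∧ 0 < s.re})
    hS (fun v _ hs => norm_thinFactor_sub_one_le v hs.1) (fun v _ hs => ?_) ⟨hs, hs0⟩
  have h := one_sub_mul_residueCard_cpow_neg_ne_zero v.1 (c := 1) (by simp) hs.2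
  rwa [one_mul] at h

/-- `E_S` is continuous at every point of `re s > σ₀` (so `E_S(s) → E_S(1)` as `s → 1` when `σ₀ < 1`). [folklore] -/
theorem tendsto_thinEulerFactor (hS : Summable fun v : S => ((v : HeightOneSpectrum (𝓞 K)).residueCard : ℝ) ^ (-σ₀))
    {s₀ : ℂ} (hs₀ : σ₀ < s₀.re) :
    Tendsto (fun s : ℂ => ∏' v : S, (1 - ((v : HeightOneSpectrum (𝓞 K)).residueCard : ℂ) ^ (-s))) (𝓝 s₀)
      (𝓝 (∏' v : S, (1 - ((v : HeightOneSpectrum (𝓞 K)).residueCard : ℂ) ^ (-s₀)))) :=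
  (((differentiableOn_thinEulerFactor hS).differentiableAt
    ((isOpen_lt continuous_const continuous_re).mem_nhds hs₀)).continuousAt).tendsto

end Thin

/-! ## §3 Euler products on `re s > 1`: the singleton family, `ζ_K^S`, and the factorisation `ζ_K^S = ζ_K · E_S` -/

section EulerProduct

variable {S : Set (HeightOneSpectrum (𝓞 K))}

/-- Coefficients `‖c_v‖ ≤ 1` off `S`, `re s > 1`: `L^S(s, c) = partialStandardL S (v ↦ {c_v}) s` is the `HasProd`-value of
`v ∉ S ↦ (1 − c_v q_v^{-s})⁻¹` and is `≠ 0` (majorant `q_v^{-re s}`, ★ `summable_residueCard_rpow_neg`; Jacquet–Shalika (1981)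
§5 Thm. (5.3): an absolutely convergent Euler product does not vanish). [folklore] -/
theorem hasProd_partialStandardL_singleton (c : HeightOneSpectrum (𝓞 K) → ℂ) (hc : ∀ v, v ∉ S → ‖c v‖ ≤ 1)
    {s : ℂ} (hs : 1 < s.re) :
    HasProd (fun v : {v : HeightOneSpectrum (𝓞 K) // v ∉ S} => (1 - c v.1 * (v.1.residueCard : ℂ) ^ (-s))⁻¹)
        (partialStandardL S (fun v => {c v}) s) ∧
      partialStandardL S (fun v => {c v}) s ≠ 0 := by
  set F : {v : HeightOneSpectrum (𝓞 K) // v ∉ S} → ℂ := fun v => 1 - c v.1 * (v.1.residueCard : ℂ) ^ (-s) with hF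
  have hb : Summable fun v : {v : HeightOneSpectrum (𝓞 K) // v ∉ S} => (v.1.residueCard : ℝ) ^ (-s.re) :=
    (summable_residueCard_rpow_neg hs).subtype _
  have hFb : ∀ v : {v : HeightOneSpectrum (𝓞 K) // v ∉ S}, ‖F v - 1‖ ≤ (v.1.residueCard : ℝ) ^ (-s.re) := by
    intro v
    rw [hF, sub_sub_cancel_left, norm_neg, norm_mul]
    calc ‖c v.1‖ * ‖(v.1.residueCard : ℂ) ^ (-s)‖ ≤ 1 * ‖(v.1.residueCard : ℂ) ^ (-s)‖ := by
          gcongr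
          exact hc v.1 v.2
      _ = (v.1.residueCard : ℝ) ^ (-s.re) := by rw [one_mul, norm_residueCard_cpow_neg]
  have hmul : Multipliable F := multipliable_of_norm_sub_one_le_const hb hFb
  have hE0 : ∏' v, F v ≠ 0 :=
    tprod_ne_zero_of_summable_norm_sub_one (hb.of_nonneg_of_le (fun _ => norm_nonneg _) hFb)
      (fun v => one_sub_mul_residueCard_cpow_neg_ne_zero v.1 (hc v.1 v.2) (zero_lt_one.trans hs))
  have hinv : HasProd (fun v => (F v)⁻¹) (∏' v, F v)⁻¹ := by
    have h := hmul.hasProd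
    unfold HasProd at h ⊢
    simpa only [Finset.prod_inv_distrib] using h.inv₀ hE0
  have hval : partialStandardL S (fun v => {c v}) s = (∏' v, F v)⁻¹ := by
    rw [← hinv.tprod_eq]
    unfold partialStandardL
    refine tprod_congr fun v => ?_
    rw [eval_eulerPolynomial_singleton]
  refine ⟨?_, ?_⟩
  · rw [hval]; exact hinv
  · rw [hval]; exact inv_ne_zero hE0

/-- `L^S(s, c)`, `‖c_v‖ ≤ 1`, is **holomorphic on `re s > 1`** (★ `differentiableOn_partialStandardL_of_norm_sub_one_le` on
`re s > σ₁ > 1`, majorant `q_v^{-σ₁}`, glued by ★ `differentiableOn_halfPlane_of_forall_lt`). [folklore] -/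
theorem differentiableOn_partialStandardL_singleton (c : HeightOneSpectrum (𝓞 K) → ℂ) (hc : ∀ v, v ∉ S → ‖c v‖ ≤ 1) :
    DifferentiableOn ℂ (partialStandardL S (fun v => {c v})) {s : ℂ | 1 < s.re} := by
  refine differentiableOn_halfPlane_of_forall_lt fun σ₁ hσ₁ => ?_
  refine (differentiableOn_partialStandardL_of_norm_sub_one_le
    (u := fun v => (v.1.residueCard : ℝ) ^ (-σ₁))
    ((summable_residueCard_rpow_neg hσ₁).subtype _) (fun v s hs => ?_) (fun v s hs => ?_)).1
  · rw [eval_eulerPolynomial_singleton, sub_sub_cancel_left, norm_neg, norm_mul]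
    calc ‖c v.1‖ * ‖(v.1.residueCard : ℂ) ^ (-s)‖ ≤ 1 * ‖(v.1.residueCard : ℂ) ^ (-s)‖ := by
          gcongr
          exact hc v.1 v.2
      _ ≤ (v.1.residueCard : ℝ) ^ (-σ₁) := by rw [one_mul]; exact norm_residueCard_cpow_neg_le _ hs.le
  · rw [eval_eulerPolynomial_singleton]
    exact one_sub_mul_residueCard_cpow_neg_ne_zero v.1 (hc v.1 v.2) (by linarith)

/-- **`ζ_K^S` converges on `re s > 1`, for ANY `S`**: `HasProd (v ∉ S ↦ (1 − q_v^{-s})⁻¹) ζ_K^S(s)` and `ζ_K^S(s) ≠ 0`,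
`ζ_K^S(s) = partialStandardL S (fun _ => {1}) s` (Neukirch VII (5.2); `c = 1` above). [folklore] -/
theorem hasProd_partialDedekindZeta {s : ℂ} (hs : 1 < s.re) :
    HasProd (fun v : {v : HeightOneSpectrum (𝓞 K) // v ∉ S} => (1 - (v.1.residueCard : ℂ) ^ (-s))⁻¹)
        (partialStandardL S (fun _ => {1}) s) ∧
      partialStandardL S (fun _ => {1}) s ≠ 0 := by
  have h := hasProd_partialStandardL_singleton (S := S) (fun _ => (1 : ℂ)) (fun _ _ => by simp) hs
  simpa only [one_mul] using h

/-- `ζ_K^S` is holomorphic on `re s > 1` (any `S`). [folklore] -/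
theorem differentiableOn_partialDedekindZeta :
    DifferentiableOn ℂ (partialStandardL S (fun _ => ({1} : Multiset ℂ))) {s : ℂ | 1 < s.re} :=
  differentiableOn_partialStandardL_singleton (S := S) (fun _ => (1 : ℂ)) (fun _ _ => by simp)

variable {σ₀ : ℝ}

/-- **FACTORISATION `ζ_K^S(s) = ζ_K(s) · E_S(s)` on `re s > 1`, `re s > σ₀`**: split the tree's Euler product ★
`hasProd_dedekindEulerFactor_holds` (Neukirch VII (5.2); `dedekindEulerFactor K v s = (1 − q_v^{-s})⁻¹` by `rfl`) over `S` and
its complement (Mathlib `HasProd.mul_compl`, uniqueness of limits), the `S`-part being `E_S(s)⁻¹`. [folklore] -/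
theorem partialDedekindZeta_eq_dedekindZeta_mul
    (hS : Summable fun v : S => ((v : HeightOneSpectrum (𝓞 K)).residueCard : ℝ) ^ (-σ₀))
    {s : ℂ} (hs : 1 < s.re) (hsσ : σ₀ < s.re) :
    partialStandardL S (fun _ => {1}) s =
      dedekindZeta K s * ∏' v : S, (1 - ((v : HeightOneSpectrum (𝓞 K)).residueCard : ℂ) ^ (-s)) := by
  set E : ℂ := ∏' v : S, (1 - ((v : HeightOneSpectrum (𝓞 K)).residueCard : ℂ) ^ (-s)) with hE
  have hE0 : E ≠ 0 := thinEulerFactor_ne_zero hS hsσ (zero_lt_one.trans hs)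
  have hSpart : HasProd (fun v : S => (1 - ((v : HeightOneSpectrum (𝓞 K)).residueCard : ℂ) ^ (-s))⁻¹) E⁻¹ := by
    have h := hasProd_thinEulerFactor hS hsσ
    unfold HasProd at h ⊢
    simpa only [Finset.prod_inv_distrib] using h.inv₀ hE0
  have hCpart := (hasProd_partialDedekindZeta (S := S) hs).1
  have hall : HasProd (fun v : HeightOneSpectrum (𝓞 K) => (1 - (v.residueCard : ℂ) ^ (-s))⁻¹)
      (dedekindZeta K s) :=
    hasProd_dedekindEulerFactor_holds (K := K) hs
  have hprod : HasProd (fun v : HeightOneSpectrum (𝓞 K) => (1 - (v.residueCard : ℂ) ^ (-s))⁻¹)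
      (E⁻¹ * partialStandardL S (fun _ => {1}) s) :=
    HasProd.mul_compl (s := S) hSpart hCpart
  have huniq : dedekindZeta K s = E⁻¹ * partialStandardL S (fun _ => {1}) s := hall.unique hprod
  calc partialStandardL S (fun _ => {1}) s
      = E * (E⁻¹ * partialStandardL S (fun _ => {1}) s) := by
        rw [← mul_assoc, mul_inv_cancel₀ hE0, one_mul]
    _ = dedekindZeta K s * E := by rw [← huniq, mul_comm]

/-- **`ζ_K^S(s) = dedekindZetaCont K s · E_S(s)` on `re s > 1`, `re s > σ₀`** (Hecke ★
`NumberField.isDedekindZetaContinuation_dedekindZetaCont_holds` `.eqOn`); the right side is the continuation of §4. [folklore] -/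
theorem partialDedekindZeta_eq_dedekindZetaCont_mul
    (hS : Summable fun v : S => ((v : HeightOneSpectrum (𝓞 K)).residueCard : ℝ) ^ (-σ₀))
    {s : ℂ} (hs : 1 < s.re) (hsσ : σ₀ < s.re) :
    partialStandardL S (fun _ => {1}) s =
      dedekindZetaCont K s * ∏' v : S, (1 - ((v : HeightOneSpectrum (𝓞 K)).residueCard : ℂ) ^ (-s)) := by
  rw [partialDedekindZeta_eq_dedekindZeta_mul hS hs hsσ,
    (NumberField.isDedekindZetaContinuation_dedekindZetaCont_holds K).eqOn hs]

end EulerProduct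

/-! ## §4 Continuation to `re s > σ₀`, the simple pole at `s = 1`, non-vanishing on `re s ≥ 1` -/

section Pole

variable {S : Set (HeightOneSpectrum (𝓞 K))} {σ₀ : ℝ}

/-- **Continuation**: `s ↦ dedekindZetaCont K s · E_S(s)` is holomorphic on `{σ₀ < re s} ∖ {1}` (Hecke, §2). [folklore] -/
theorem differentiableOn_dedekindZetaCont_mul_thinEulerFactor
    (hS : Summable fun v : S => ((v : HeightOneSpectrum (𝓞 K)).residueCard : ℝ) ^ (-σ₀)) :
    DifferentiableOn ℂ
      (fun s : ℂ => dedekindZetaCont K s * ∏' v : S, (1 - ((v : HeightOneSpectrum (𝓞 K)).residueCard : ℂ) ^ (-s)))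
      ({s : ℂ | σ₀ < s.re} \ {1}) :=
  ((NumberField.isDedekindZetaContinuation_dedekindZetaCont_holds K).differentiableOn.mono
      fun _ hs => hs.2).mul
    ((differentiableOn_thinEulerFactor hS).mono fun _ hs => hs.1)

/-- **The simple pole at `s = 1`**: `(s − 1) · dedekindZetaCont K s · E_S(s) → ρ_K · E_S(1)` on `𝓝[≠] 1` (`σ₀ < 1`; ★
`tendsto_sub_one_mul_dedekindZetaCont_holds`, Neukirch VII (5.11) (ii), times continuity of `E_S` at `1`). [folklore] -/
theorem tendsto_sub_one_mul_dedekindZetaCont_mul_thinEulerFactor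
    (hS : Summable fun v : S => ((v : HeightOneSpectrum (𝓞 K)).residueCard : ℝ) ^ (-σ₀)) (hσ₀ : σ₀ < 1) :
    Tendsto (fun s : ℂ => (s - 1) *
        (dedekindZetaCont K s * ∏' v : S, (1 - ((v : HeightOneSpectrum (𝓞 K)).residueCard : ℂ) ^ (-s))))
      (𝓝[≠] 1)
      (𝓝 ((dedekindZeta_residue K : ℂ) *
        ∏' v : S, (1 - ((v : HeightOneSpectrum (𝓞 K)).residueCard : ℂ) ^ (-(1 : ℂ))))) := by
  have h1 := tendsto_sub_one_mul_dedekindZetaCont_holds K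
  have h2 := (tendsto_thinEulerFactor hS (s₀ := 1) (by simpa using hσ₀)).mono_left
    (nhdsWithin_le_nhds (s := ({1}ᶜ : Set ℂ)))
  refine (h1.mul h2).congr fun s => ?_
  ring

/-- **The residue is not zero**: `ρ_K · E_S(1) ≠ 0` (Mathlib `dedekindZeta_residue_ne_zero`; `E_S(1) ≠ 0` by §2). [folklore] -/
theorem residue_mul_thinEulerFactor_ne_zero
    (hS : Summable fun v : S => ((v : HeightOneSpectrum (𝓞 K)).residueCard : ℝ) ^ (-σ₀)) (hσ₀ : σ₀ < 1) :
    (dedekindZeta_residue K : ℂ) *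
        ∏' v : S, (1 - ((v : HeightOneSpectrum (𝓞 K)).residueCard : ℂ) ^ (-(1 : ℂ))) ≠ 0 :=
  mul_ne_zero (ofReal_ne_zero.mpr (dedekindZeta_residue_ne_zero K))
    (thinEulerFactor_ne_zero hS (by simpa using hσ₀) (by simp))

/-- **Removable singularity**: `(s − 1) · dedekindZetaCont K s · E_S(s)`, extended by `ρ_K · E_S(1)` at `s = 1`, is holomorphic
on the whole half-plane `re s > σ₀` (`σ₀ < 1`; Mathlib `Complex.differentiableOn_compl_singleton_and_continuousAt_iff`) — the form
in which file (B) consumes the pole at `s − ½ = 1`; off `1` it is the original function (`Function.update_of_ne`). [folklore] -/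
theorem differentiableOn_update_sub_one_mul
    (hS : Summable fun v : S => ((v : HeightOneSpectrum (𝓞 K)).residueCard : ℝ) ^ (-σ₀)) (hσ₀ : σ₀ < 1) :
    DifferentiableOn ℂ
      (Function.update
        (fun s : ℂ => (s - 1) *
          (dedekindZetaCont K s * ∏' v : S, (1 - ((v : HeightOneSpectrum (𝓞 K)).residueCard : ℂ) ^ (-s))))
        1 ((dedekindZeta_residue K : ℂ) *
          ∏' v : S, (1 - ((v : HeightOneSpectrum (𝓞 K)).residueCard : ℂ) ^ (-(1 : ℂ)))))
      {s : ℂ | σ₀ < s.re} := by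
  set U : Set ℂ := {s : ℂ | σ₀ < s.re} with hU
  set g : ℂ → ℂ := fun s : ℂ => (s - 1) *
    (dedekindZetaCont K s * ∏' v : S, (1 - ((v : HeightOneSpectrum (𝓞 K)).residueCard : ℂ) ^ (-s))) with hg
  set r : ℂ := (dedekindZeta_residue K : ℂ) *
    ∏' v : S, (1 - ((v : HeightOneSpectrum (𝓞 K)).residueCard : ℂ) ^ (-(1 : ℂ))) with hr
  have hU1 : U ∈ 𝓝 (1 : ℂ) :=
    (isOpen_lt continuous_const continuous_re).mem_nhds (by simpa [hU] using hσ₀)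
  have hgd : DifferentiableOn ℂ g (U \ {1}) :=
    ((differentiableOn_id.sub (differentiableOn_const _)).mul
      (differentiableOn_dedekindZetaCont_mul_thinEulerFactor hS))
  have hGg : Set.EqOn (Function.update g 1 r) g (U \ {1}) := fun s hs =>
    Function.update_of_ne (fun h => hs.2 h) _ _
  rw [← Complex.differentiableOn_compl_singleton_and_continuousAt_iff hU1]
  refine ⟨hgd.congr hGg, ?_⟩
  rw [continuousAt_update_same]
  exact tendsto_sub_one_mul_dedekindZetaCont_mul_thinEulerFactor hS hσ₀

/-- **Non-vanishing on `re s ≥ 1`**: `dedekindZetaCont K s · E_S(s) ≠ 0` for `1 ≤ re s`, `s ≠ 1` (`σ₀ < 1`; Landau ★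
`dedekindZetaCont_ne_zero_of_one_le_re_holds` and §2). [folklore] -/
theorem dedekindZetaCont_mul_thinEulerFactor_ne_zero
    (hS : Summable fun v : S => ((v : HeightOneSpectrum (𝓞 K)).residueCard : ℝ) ^ (-σ₀)) (hσ₀ : σ₀ < 1)
    {s : ℂ} (hs : 1 ≤ s.re) (hs1 : s ≠ 1) :
    dedekindZetaCont K s * ∏' v : S, (1 - ((v : HeightOneSpectrum (𝓞 K)).residueCard : ℂ) ^ (-s)) ≠ 0 :=
  mul_ne_zero (dedekindZetaCont_ne_zero_of_one_le_re_holds K hs hs1)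
    (thinEulerFactor_ne_zero hS (by linarith) (by linarith))

/-- **`ζ_K^S(s) ≠ 0` for `re s > 1`** in the continued spelling (bookkeeping for (B): the value at `s + ½ = 2`). [folklore] -/
theorem dedekindZetaCont_mul_thinEulerFactor_ne_zero_of_one_lt_re
    (hS : Summable fun v : S => ((v : HeightOneSpectrum (𝓞 K)).residueCard : ℝ) ^ (-σ₀)) (hσ₀ : σ₀ < 1)
    {s : ℂ} (hs : 1 < s.re) :
    dedekindZetaCont K s * ∏' v : S, (1 - ((v : HeightOneSpectrum (𝓞 K)).residueCard : ℂ) ^ (-s)) ≠ 0 := by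
  rw [← partialDedekindZeta_eq_dedekindZetaCont_mul hS hs (by linarith)]
  exact (hasProd_partialDedekindZeta hs).2

end Pole

/-! ## §5 Which `S` are thin: finite sets, and finite ∪ {places of residue degree ≥ 2} -/

section Which

variable {S : Set (HeightOneSpectrum (𝓞 K))}

/-- A finite set of places is thin at every exponent. [folklore] -/
theorem summable_residueCard_rpow_neg_of_finite (hS : S.Finite) (σ₀ : ℝ) :
    Summable fun v : S => ((v : HeightOneSpectrum (𝓞 K)).residueCard : ℝ) ^ (-σ₀) := by
  haveI : Finite S := hS.to_subtype
  exact Summable.of_finite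

/-- **The places of degree `≥ 2` are thin on `re s > 1/2`**: `S ⊆ S₀ ∪ {v | N(v) not a rational prime}`, `S₀` finite ⇒
`∑_{v ∈ S} q_v^{-σ} < ∞` for `σ > 1/2` (★ `summable_absNorm_rpow_neg_subtype_not_prime` + finitely many terms). [folklore] -/
theorem summable_residueCard_rpow_neg_of_subset_finite_union_not_prime {S₀ : Set (HeightOneSpectrum (𝓞 K))}
    (hS₀ : S₀.Finite) (hS : S ⊆ S₀ ∪ {v | ¬ (Ideal.absNorm v.asIdeal).Prime}) {σ : ℝ} (hσ : 1 / 2 < σ) :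
    Summable fun v : S => ((v : HeightOneSpectrum (𝓞 K)).residueCard : ℝ) ^ (-σ) := by
  classical
  set g : HeightOneSpectrum (𝓞 K) → ℝ := fun v => (v.residueCard : ℝ) ^ (-σ) with hg
  have hg0 : ∀ v, 0 ≤ g v := fun v => Real.rpow_nonneg (Nat.cast_nonneg _) _
  have hT : Summable ({v : HeightOneSpectrum (𝓞 K) | ¬ (Ideal.absNorm v.asIdeal).Prime}.indicator g) := by
    rw [← summable_subtype_iff_indicator]
    exact summable_absNorm_rpow_neg_subtype_not_prime (K := K) hσ
  have h0 : Summable (S₀.indicator g) := by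
    rw [← summable_subtype_iff_indicator]
    haveI : Finite S₀ := hS₀.to_subtype
    exact Summable.of_finite
  have hle : ∀ v, S.indicator g v ≤
      S₀.indicator g v + {v : HeightOneSpectrum (𝓞 K) | ¬ (Ideal.absNorm v.asIdeal).Prime}.indicator g v := by
    intro v
    by_cases hv : v ∈ S
    · rw [Set.indicator_of_mem hv]
      rcases hS hv with h | h
      · rw [Set.indicator_of_mem h]
        exact le_add_of_nonneg_right (Set.indicator_nonneg (fun w _ => hg0 w) v)
      · rw [Set.indicator_of_mem h]
        exact le_add_of_nonneg_left (Set.indicator_nonneg (fun w _ => hg0 w) v)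
    · rw [Set.indicator_of_notMem hv]
      exact add_nonneg (Set.indicator_nonneg (fun w _ => hg0 w) v) (Set.indicator_nonneg (fun w _ => hg0 w) v)
  have hSind : Summable (S.indicator g) :=
    Summable.of_nonneg_of_le (fun v => Set.indicator_nonneg (fun w _ => hg0 w) v) hle (h0.add hT)
  exact (summable_subtype_iff_indicator).mpr hSind

/-- Inertia-degree spelling: `S ⊆ S₀ ∪ {v | 2 ≤ f(v|p)}` with `S₀` finite is thin on `re s > 1/2`
(★ `not_prime_absNorm_iff_two_le_inertiaDeg`). [folklore] -/
theorem summable_residueCard_rpow_neg_of_subset_finite_union_two_le_inertiaDeg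
    {S₀ : Set (HeightOneSpectrum (𝓞 K))} (hS₀ : S₀.Finite)
    (hS : S ⊆ S₀ ∪ {v | 2 ≤ v.asIdeal.inertiaDeg ℤ}) {σ : ℝ} (hσ : 1 / 2 < σ) :
    Summable fun v : S => ((v : HeightOneSpectrum (𝓞 K)).residueCard : ℝ) ^ (-σ) := by
  refine summable_residueCard_rpow_neg_of_subset_finite_union_not_prime hS₀ (fun v hv => ?_) hσ
  rcases hS hv with h | h
  · exact Or.inl h
  · exact Or.inr ((not_prime_absNorm_iff_two_le_inertiaDeg (K := K) v).mpr h)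

end Which

end Summit.HodgeConjecture.HodgeConjecture.Cruxes.H413.F0P2wPartialDedekindZetaPole

end
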